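import Literature.AlgebraicGeometry.Hu2025.Statements.S07GammaSchemes.R109aGamma
import Literature.AlgebraicGeometry.Hu2025.Proofs.S07GammaSchemes.ChartReadings
import Literature.AlgebraicGeometry.Hu2025.Proofs.S07GammaSchemes.StrictTransformShape
import Mathlib.RingTheory.Ideal.Quotient.Operations
import Mathlib.RingTheory.Ideal.MinimalPrime.Basic
import HarnessLib

/-!
# Hu 2025 (arXiv:2507.21400v1) §7.2, Lemma 7.3 — the induction base `k = 0` IN GENERAL (C57L144–L153, p.130: «𝔙 = 𝐔 …
# Z_{𝔉[0],Γ} = Z†_{𝔉[0],Γ} := Z_Γ … Γ̃⁰_𝔙 = Γ. Then, the statement holds trivially.») — KERNEL SUPPORT over the typed carriers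
# of row 109 (`R109aGamma.lean`, `R109bFTransforms.lean`): which conjuncts of the typed `Lem7_3` hold for the printed base data,
# for EVERY field `𝔽`, index type `σ`, relation family `rels` (`𝔉 = range rels`) and finite `Γ`

**Honest framing (D-0012/D-0089).** Kernel facts about TYPED decls, taking no side on the manuscript [Hu2025] (arXiv:2507.21400v1,
`paper:arxiv-2507.21400`, UNREFEREED, under adjudication at rung M-Hu-min of the campaign `res-hironaka`); nothing of [Hu2025] is
asserted; AI proving is weaker than expert review. Provenance: res-type-016 (typer of record of row 109). For the base data
`baseData rels Γ = ⟨I_{℘,Γ}, I_{℘,Γ}, Γ, ∅⟩` on the unique chart `𝔙 = 𝐔` (structure map `id`, `𝒱_[0] ∩ 𝐔 = Z_∅` with ideal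
`I_{℘,∅} = ⟨𝔉⟩`, C57L29–L31; relation family of item (1) at `k = 0` = the `F̄_{𝔙,j}`, `0 < j ≤ Υ`, i.e. `rels` itself; the
families `B`, `L` over `i ∈ [0] = ∅` are empty):
* `lem7_3_bullets_base` — the three bullets hold given «Z_Γ integral» in the typed form `ZGammaIntegral` (then `I_{℘,Γ}` is prime,
  hence its own minimal prime: `IsComponent`);
* `lem7_3_1_base` — item (1) holds (`I_{℘,Γ} = ⟨x_y (y ∈ Γ), 𝔉⟩`), any `hInt`;
* `lem7_3_2_base` — item (2) holds (the identity `Z† = Z_Γ → Z_Γ` is birational), any `hInt`;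
* `lem7_3_3_base` — item (3) holds (`Z† = Z`), any `hInt`;
* `gamma0Maximal_base_iff` — the MAXIMALITY CLAUSE holds for `Γ̃⁰_𝐔 := Γ` IFF «every variable lying in `I_{℘,Γ}` is indexed by
  `Γ`» (`∀ y, x_y ∈ I_{℘,Γ} → y ∈ Γ`); `lem7_3_1max_base_iff` — so, when `Z_Γ` is integral, the typed `Lem7_3_1max` at the base
  data is EQUIVALENT to that condition (false for `n = 5`, `Γ = {x₁₂₄, x₁₃₄}`: `Lem73BaseMaximality.lean`; true for the Segre cone:
  `ToyGammaIntegrality.lean`).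
So «the statement holds trivially» (C57L153) is kernel-true for every conjunct except the maximality clause read as a claim about
`Γ̃⁰_𝐔 := Γ`, whose truth is exactly the displayed condition; `lem7_3_base_iff` packages this: the typed `Lem7_3` at the base
data (given `ZGammaIntegral`) ⟺ `∀ y, x_y ∈ I_{℘,Γ} → y ∈ Γ`. Under the DEFINITION reading (OURS `gamma0Sat`: `Γ̃⁰_𝐔 := S` with
`↑S = {y | x_y ∈ I_{℘,Γ}} ⊇ Γ`, data `baseDataWith rels Γ S`) the whole typed `Lem7_3` holds at the base with no extra condition
(`lem7_3_base_of_gamma0Sat`). Which reading of the clause is intended is for the M-Hu adjudication.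

## References
* [Hu2025] Y. Hu, arXiv:2507.21400v1 (2025), Def. 7.1 C57L9–L31 (p.128); Lem. 7.3 C57L79–L153 (p.129–130) — loci of the typed
  definitions only (unrefereed manuscript under adjudication).
-/

noncomputable section

namespace Literature.AlgebraicGeometry.Hu2025.Statements.S07GammaSchemes

open MvPolynomial GammaTransformChart

universe u

variable {σ : Type u} {𝔽 : Type u} [Field 𝔽] {ι : Type*}

/-- **The base data of the induction, C57L144–L151 (p.130)**: on the unique chart `𝔙 = 𝐔` of `ℛ_{𝔉[0]} = 𝐔`,
«Z_{𝔉[0],Γ} = Z†_{𝔉[0],Γ} := Z_Γ» (chart ideal `I_{℘,Γ}` twice) and «Γ̃⁰_𝔙 = Γ», with `Γ̃¹ = ∅` (C60L40). Here `𝔉 = range rels`.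
[cite: Hu2025, Lem. 7.3 proof C57L144–L151; p.130 (unrefereed manuscript under adjudication — kernel support over the typed carriers, nothing of the manuscript asserted)] -/
def baseData (rels : ι → MvPolynomial σ 𝔽) (Γ : Finset σ) : GammaTransformChart σ (MvPolynomial σ 𝔽) :=
  ⟨gammaWpIdeal (Set.range rels) (Γ : Set σ), gammaWpIdeal (Set.range rels) (Γ : Set σ), Γ, ∅⟩

/-- **Item (1) at `k = 0`**: `I(Z_Γ) = I_{℘,Γ} = ⟨x_y (y ∈ Γ), F̄ (F̄ ∈ 𝔉)⟩` — definitionally the typed `DefinedBy` for the base data.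
[cite: Hu2025, Lem. 7.3 (1) C57L107–L125 with proof C57L144–L153; p.129–130 (unrefereed manuscript under adjudication — kernel support, nothing asserted)] -/
theorem definedBy_base (rels : ι → MvPolynomial σ 𝔽) (Γ : Finset σ) : (baseData rels Γ).DefinedBy X X rels := by
  show (baseData rels Γ).zIdeal = _
  simp only [baseData, Finset.coe_empty, Set.image_empty, Set.union_empty, Ideal.span_union]
  rfl

/-- `Lem7_3_1` holds for the base data (any `hInt`). [cite: Hu2025, Lem. 7.3 (1) / proof C57L153; p.130 (unrefereed manuscript under adjudication — kernel support, nothing asserted)] -/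
theorem lem7_3_1_base (hInt : Prop) (rels : ι → MvPolynomial σ 𝔽) (Γ : Finset σ) :
    Lem7_3_1 hInt X rels (baseData rels Γ) := fun _ _ => definedBy_base rels Γ

/-- **The three bullets at `k = 0`** (structure map `id : 𝔽[x] → 𝔽[x]`, `𝒱_[0] ∩ 𝐔 = Z_∅` with ideal `⟨𝔉⟩`): `Z_Γ` lies over
`Z_Γ` and inside `Z_∅`; given «Z_Γ integral» (`ZGammaIntegral`) the ideal `I_{℘,Γ}` is prime, hence an (the) irreducible
component of itself; `Γ̃¹ = ∅`.
[cite: Hu2025, Lem. 7.3 bullets C57L84–L100 with proof C57L144–L153; p.129–130 (unrefereed manuscript under adjudication — kernel support, nothing asserted)] -/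
theorem lem7_3_bullets_base (rels : ι → MvPolynomial σ 𝔽) (Γ : Finset σ) :
    Lem7_3_bullets (ZGammaIntegral (Set.range rels) (Γ : Set σ)) (RingHom.id (MvPolynomial σ 𝔽))
      (gammaWpIdeal (Set.range rels) (Γ : Set σ)) (Ideal.span (Set.range rels)) (baseData rels Γ) := by
  intro hInt _
  refine ⟨⟨le_sup_right, by simp [baseData, Ideal.map_id]⟩, ?_, rfl⟩
  intro _
  haveI : IsDomain (GammaSchemeRing (Set.range rels) (Γ : Set σ)) := hInt
  haveI : (gammaWpIdeal (Set.range rels) (Γ : Set σ)).IsPrime :=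
    (Ideal.Quotient.isDomain_iff_prime _).mp inferInstance
  show gammaWpIdeal (Set.range rels) (Γ : Set σ) ∈ Ideal.minimalPrimes (gammaWpIdeal (Set.range rels) (Γ : Set σ))
  rw [Ideal.minimalPrimes_eq_subsingleton_self]
  exact Set.mem_singleton _

/-- **Item (2) at `k = 0`**: the identity `Z† = Z_Γ → Z_Γ` is birational (any `hInt`).
[cite: Hu2025, Lem. 7.3 (2) C57L131–L133 with proof C57L147; p.130 (unrefereed manuscript under adjudication — kernel support, nothing asserted)] -/
theorem lem7_3_2_base (hInt : Prop) (rels : ι → MvPolynomial σ 𝔽) (Γ : Finset σ) :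
    Lem7_3_2 hInt (baseData rels Γ) (RingHom.id (GammaSchemeRing (Set.range rels) (Γ : Set σ))) :=
  fun _ => birational_id (baseData rels Γ)

/-- **Item (3) at `k = 0`**: `Z† = Z`, so the containment equivalence is trivial (any `hInt`).
[cite: Hu2025, Lem. 7.3 (3) C57L135–L139 with proof C57L147; p.130 (unrefereed manuscript under adjudication — kernel support, nothing asserted)] -/
theorem lem7_3_3_base (hInt : Prop) (rels : ι → MvPolynomial σ 𝔽) (Γ : Finset σ) :
    Lem7_3_3 hInt X (baseData rels Γ) := fun _ _ _ => Iff.rfl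

/-- **The maximality clause at `k = 0`, unfolded**: `Γ̃⁰_𝐔 := Γ` is maximal (equivalently greatest) among the index sets
satisfying item (1) IFF every variable lying in `I_{℘,Γ}` is indexed by `Γ`.
[cite: Hu2025, Lem. 7.3 (1) C57L127–L129 with proof C57L151–L153 «Γ̃⁰_𝔙 = Γ. Then, the statement holds trivially.»; p.130 (unrefereed manuscript under adjudication — kernel fact about the typed reading, nothing of the manuscript asserted or denied)] -/
theorem gamma0Maximal_base_iff [DecidableEq σ] (rels : ι → MvPolynomial σ 𝔽) (Γ : Finset σ) :
    (baseData rels Γ).Gamma0Maximal X X rels ↔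
      ∀ y : σ, (X y : MvPolynomial σ 𝔽) ∈ gammaWpIdeal (Set.range rels) (Γ : Set σ) → y ∈ Γ :=
  gamma0Maximal_iff (baseData rels Γ) (definedBy_base rels Γ)

/-- **`Lem7_3_1max` at the base data, given «Z_Γ integral»**: equivalent to «`∀ y, x_y ∈ I_{℘,Γ} → y ∈ Γ`» (the hypothesis
`ZGammaIntegral` and the chart condition `I_{℘,Γ} ≠ ⊤` both hold, so the guarded implication is its conclusion).
[cite: Hu2025, Lem. 7.3 (1) C57L127–L129 / proof C57L151–L153; p.130 (unrefereed manuscript under adjudication — kernel fact about the typed reading, nothing asserted or denied)] -/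
theorem lem7_3_1max_base_iff [DecidableEq σ] (rels : ι → MvPolynomial σ 𝔽) (Γ : Finset σ)
    (hInt : ZGammaIntegral (Set.range rels) (Γ : Set σ)) :
    Lem7_3_1max (ZGammaIntegral (Set.range rels) (Γ : Set σ)) X rels (baseData rels Γ) ↔
      ∀ y : σ, (X y : MvPolynomial σ 𝔽) ∈ gammaWpIdeal (Set.range rels) (Γ : Set σ) → y ∈ Γ := by
  have hne : (baseData rels Γ).zIdeal ≠ ⊤ := by
    haveI : IsDomain (GammaSchemeRing (Set.range rels) (Γ : Set σ)) := hInt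
    have hp : (gammaWpIdeal (Set.range rels) (Γ : Set σ)).IsPrime :=
      (Ideal.Quotient.isDomain_iff_prime _).mp inferInstance
    exact hp.ne_top
  rw [← gamma0Maximal_base_iff]
  exact ⟨fun h => h hInt hne, fun h _ _ => h⟩

/-- **The whole typed `Lem7_3` at the base data, given «Z_Γ integral», is EQUIVALENT to the maximality condition**
`∀ y, x_y ∈ I_{℘,Γ} → y ∈ Γ` (all other conjuncts hold unconditionally).
[cite: Hu2025, Lem. 7.3 C57L79–L139 with proof C57L144–L153 «Then, the statement holds trivially.»; p.129–130 (unrefereed manuscript under adjudication — kernel fact about the typed statement at the printed base data, nothing of the manuscript asserted or denied)] -/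
theorem lem7_3_base_iff [DecidableEq σ] (rels : ι → MvPolynomial σ 𝔽) (Γ : Finset σ)
    (hInt : ZGammaIntegral (Set.range rels) (Γ : Set σ)) :
    Lem7_3 (ZGammaIntegral (Set.range rels) (Γ : Set σ)) (RingHom.id (MvPolynomial σ 𝔽))
        (gammaWpIdeal (Set.range rels) (Γ : Set σ)) (Ideal.span (Set.range rels)) X rels (baseData rels Γ)
        (RingHom.id (GammaSchemeRing (Set.range rels) (Γ : Set σ))) ↔
      ∀ y : σ, (X y : MvPolynomial σ 𝔽) ∈ gammaWpIdeal (Set.range rels) (Γ : Set σ) → y ∈ Γ := by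
  rw [← lem7_3_1max_base_iff rels Γ hInt]
  constructor
  · exact fun h => h.2.2.1
  · intro hmax
    exact ⟨lem7_3_bullets_base rels Γ, lem7_3_1_base _ rels Γ, hmax, lem7_3_2_base _ rels Γ, lem7_3_3_base _ rels Γ⟩

/-! ## The base `k = 0` under the DEFINITION reading of «the maximal subset» (OURS `gamma0Sat`) -/

/-- **Base data with a prescribed `Γ̃⁰` slot**: the same chart ideals as `baseData` («Z_{𝔉[0],Γ} = Z†_{𝔉[0],Γ} := Z_Γ» on
`𝔙 = 𝐔`, C57L147), `Γ̃¹ = ∅`, but `Γ̃⁰_𝐔 := S` for a finite index set `S` — used with `↑S = {y | x_y ∈ I_{℘,Γ}}`, i.e. the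
definition reading `gamma0Sat` of C57L127–L129 in place of the printed `Γ̃⁰_𝔙 = Γ` (C57L151).
[cite: Hu2025, Lem. 7.3 (1) C57L127–L129 with proof C57L144–L151; p.130 (unrefereed manuscript under adjudication — kernel support over the typed carriers, nothing of the manuscript asserted)] -/
def baseDataWith (rels : ι → MvPolynomial σ 𝔽) (Γ S : Finset σ) : GammaTransformChart σ (MvPolynomial σ 𝔽) :=
  ⟨gammaWpIdeal (Set.range rels) (Γ : Set σ), gammaWpIdeal (Set.range rels) (Γ : Set σ), S, ∅⟩

/-- The definition-reading set at the base data is `{y | x_y ∈ I_{℘,Γ}}` (by `rfl`).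
[cite: Hu2025, Lem. 7.3 (1) C57L127–L129; p.130 (unrefereed manuscript under adjudication — kernel support over the typed reading, nothing asserted)] -/
theorem gamma0Sat_baseData (rels : ι → MvPolynomial σ 𝔽) (Γ : Finset σ) :
    (baseData rels Γ).gamma0Sat X =
      {y | (X y : MvPolynomial σ 𝔽) ∈ gammaWpIdeal (Set.range rels) (Γ : Set σ)} := rfl

/-- `Γ ⊆ {y | x_y ∈ I_{℘,Γ}}`: the definition-reading set at `k = 0` contains the printed `Γ̃⁰_𝐔 = Γ` (it may be larger:
`Lem73BaseMaximality.lean`). [cite: Hu2025, Lem. 7.3 proof C57L151 «Γ̃⁰_𝔙 = Γ»; p.130 (unrefereed manuscript under adjudication — kernel support over the typed reading, nothing asserted)] -/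
theorem coe_subset_gamma0Sat_baseData (rels : ι → MvPolynomial σ 𝔽) (Γ : Finset σ) :
    (Γ : Set σ) ⊆ (baseData rels Γ).gamma0Sat X := fun y hy =>
  Ideal.mem_sup_left (Ideal.subset_span ⟨y, hy, rfl⟩)

/-- **Lemma 7.3 at `k = 0` holds IN FULL under the definition reading**: if `↑S = {y | x_y ∈ I_{℘,Γ}}` (`= gamma0Sat`), the
chart data `⟨I_{℘,Γ}, I_{℘,Γ}, S, ∅⟩` satisfies every conjunct of the typed `Lem7_3` — bullets (given «Z_Γ integral»), item (1),
the MAXIMALITY CLAUSE, item (2), item (3). Together with `lem7_3_base_iff` (printed data `Γ̃⁰_𝐔 := Γ`): at the base the two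
readings differ exactly when some chart variable outside `Γ` lies in `I_{℘,Γ}`. Which reading is meant is for the adjudication.
[cite: Hu2025, Lem. 7.3 C57L79–L139 with proof C57L144–L153 «Then, the statement holds trivially.»; p.129–130 (unrefereed manuscript under adjudication — kernel fact about the typed statement under the OURS definition reading, nothing of the manuscript asserted or denied)] -/
theorem lem7_3_base_of_gamma0Sat [DecidableEq σ] (rels : ι → MvPolynomial σ 𝔽) (Γ S : Finset σ)
    (hS : (S : Set σ) = (baseData rels Γ).gamma0Sat X) :
    Lem7_3 (ZGammaIntegral (Set.range rels) (Γ : Set σ)) (RingHom.id (MvPolynomial σ 𝔽))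
        (gammaWpIdeal (Set.range rels) (Γ : Set σ)) (Ideal.span (Set.range rels)) X rels (baseDataWith rels Γ S)
        (RingHom.id (GammaSchemeRing (Set.range rels) (Γ : Set σ))) := by
  -- item (1) at `S`: `S = gamma0Sat` satisfies (1) because the printed `Γ` does (`definedByWith_gamma0Sat`);
  -- `baseData` and `baseDataWith` have the same chart ideal and the same (empty) `Γ̃¹`, so the predicate transfers by `rfl`.
  have h1 : (baseDataWith rels Γ S).DefinedBy X X rels := by
    have h := (definedByWith_gamma0Sat (baseData rels Γ) (definedBy_base rels Γ) S hS).1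
    unfold DefinedBy
    unfold DefinedByWith at h ⊢
    exact h
  have hbul : Lem7_3_bullets (ZGammaIntegral (Set.range rels) (Γ : Set σ)) (RingHom.id (MvPolynomial σ 𝔽))
      (gammaWpIdeal (Set.range rels) (Γ : Set σ)) (Ideal.span (Set.range rels)) (baseDataWith rels Γ S) := by
    have h := lem7_3_bullets_base rels Γ
    unfold Lem7_3_bullets LiesOverGamma IsComponent at h ⊢
    exact h
  refine ⟨hbul, fun _ _ => h1, ?_, fun _ => birational_id _, fun _ _ _ => Iff.rfl⟩
  intro _ _
  refine (gamma0Maximal_iff (baseDataWith rels Γ S) h1).2 fun y hy => ?_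
  have hy' : y ∈ (baseData rels Γ).gamma0Sat X := hy
  rw [← hS] at hy'
  exact Finset.mem_coe.mp hy'

end Literature.AlgebraicGeometry.Hu2025.Statements.S07GammaSchemes

end
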